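import Summits.MatrixMultiplication.MatrixMultiplication.Theorems.AbelianSTPPCensusTALin1200Defs

/-!
# T_A/1200 certificate: kernel evaluation, volumes `801 … 850` (segment 17)

Cell mm-stpp (rung F-M1), T_A/1200 = «no abelian STPP host of order `≤ 1200` beats `τ = 2.371`»; checker and checkpoint states in
`AbelianSTPPCensusTALin1200Defs.lean` (linear one-pass certificate: vM densities + the Grynkiewicz budget of the maximal member).  `decide` with
kernel reduction (standard axioms; no `native_decide`; ≈ 3 min on the farm); ONE segment per file and `Elab.async false` so that a single kernel
evaluation is in memory at a time (two 50-volume segments in one file exhausted the kernel's memory at volumes `> 400`).  The segment recomputes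
the next checkpoint state from the previous one and checks every sorted candidate shape of its volumes at every order `576 … 1200`; consumed by
`TALin1200.seg_sound` / `TALin1200.loopL_sound` in `AbelianSTPPCensusLeafTA1200Closed.lean`.
WHAT THIS IS NOT: arithmetic on shape lists only; no statement about STPP families or `ω`.
-/

set_option linter.dupNamespace false
set_option autoImplicit false
set_option Elab.async false

namespace Summit.MatrixMultiplication.MatrixMultiplication.Theorems.TALin1200

set_option maxHeartbeats 0 in
/-- Segment 17: volumes `801 … 850` from `st800` reach the checkpoint `st850`, all checks at orders `576 … 1200` passing. [original] -/
theorem seg17 : loopL 576 625 50 801 st800 = (true, st850) := by decide +kernel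

end Summit.MatrixMultiplication.MatrixMultiplication.Theorems.TALin1200
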